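import Literature.Analysis.FluidPDE.HeatGradDivCalculus
import Literature.Analysis.FluidPDE.HeatFlowLocalEnstrophy
import Literature.Analysis.FluidPDE.WholeSpaceIBPIntegrable
import Literature.Analysis.FluidPDE.MildL3Restart
import Literature.Analysis.FunctionSpaces.MinkowskiIntegral
import HarnessLib

/-!
# `L²` bound of the truncated Leray-type corrector `∫_ε^R ∇div e^{σΔ}g dσ`

Analysis/FluidPDE support file (theorems only) on the discharge path of
`Literature.Analysis.FluidPDE.AlbrittonBarker2019_liouville_weakL3_backward`, step
"initial layer for weak-`L³` data" (Barker–Seregin–Šverák, arXiv:1603.03211, Lemma 3.4), whose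
splitting `u₀ = ḡ + g̃` (loc. cit., Lemma 2.1) is made divergence free here by the heat-subordinated
corrector `∫ ∇div e^{σΔ}g dσ` instead of the Leray projector. This file proves that this
corrector is `L²`-bounded in terms of `‖g‖_{L²}` alone (the substitute for the `L²`-boundedness
of the Leray projector):

* `lintegral_frobeniusNormSq_fderiv_heatExtension_le` — **the global enstrophy bound of the heat
  flow**, `∫₀^∞ ∫ |∇e^{τΔ}g|² ≤ ‖g‖²_{L²}` (from the tree's uniformly local bound
  `setLIntegral_box_frobeniusNormSq_fderiv_heatExtension_le` by exhaustion);
* `lintegral_divergence_heatExtension_sq_le` — hence `∫₀^∞ ‖div e^{sΔ}g‖²_{L²} ds ≤ ‖tr‖² ‖g‖²_{L²}`;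
* `integral_inner_gradDiv_heatExtension_eq` — the pairing identity
  `∫⟪∇div e^{σΔ}g, h⟫ = -∫ (div e^{(σ/2)Δ}g)(div e^{(σ/2)Δ}h)` (symmetry of the heat semigroup
  and integration by parts on the whole space);
* `abs_integral_inner_gradDiv_heatExtension_le`, `integral_Ioc_integral_divergence_sq_le`,
  `memLp_integral_gradDiv_heatExtension` (Minkowski), `abs_integral_inner_integral_gradDiv_le`
  (Fubini) — the pairing of the truncated corrector with an `L²` field;
* `eLpNorm_integral_gradDiv_heatExtension_le` — **the `L²` bound**
  `‖∫_{(ε,R]} ∇div e^{σΔ}g dσ‖_{L²} ≤ 2(‖tr‖² + 1) ‖g‖_{L²}` for bounded measurable `g ∈ L²`, `0 < ε`.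

## References

* T. Barker, G. Seregin, V. Šverák, *On stability of weak Navier–Stokes solutions with large
  `L^{3,∞}` initial data*, Comm. PDE 43 (2018) = arXiv:1603.03211, Lemma 2.1, Lemma 3.4.
  [`BarkerSeregin2016`]
* P. G. Lemarié-Rieusset, *The Navier–Stokes Problem in the 21st Century* (2016), Thm. 14.1,
  proof, Step 1 (local enstrophy of the heat flow). [`LemarieRieusset2016`]
-/

noncomputable section

open MeasureTheory Set Function Filter Metric TopologicalSpace InnerProductSpace
open _root_.Topology
open scoped NNReal ENNReal Laplacian RealInnerProductSpace

namespace Literature.Analysis.FluidPDE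

open UnboundedOperators

variable {E : Type*} [NormedAddCommGroup E] [InnerProductSpace ℝ E] [FiniteDimensional ℝ E]
  [MeasurableSpace E] [BorelSpace E]

/-! ### The global enstrophy bound of the heat flow -/

section Enstrophy

variable {F' : Type*} [NormedAddCommGroup F'] [InnerProductSpace ℝ F'] [FiniteDimensional ℝ F']

/-- **Global enstrophy bound of the heat flow**: for `g ∈ L²`,
`∫∫_{(0,∞) × E} |∇e^{τΔ}g|²_F ≤ ‖g‖²_{L²}` (the uniformly local bound of Lemarié-Rieusset 2016,
Thm. 14.1, Step 1, on the boxes `(t/(k+2), t) × B_{k+1}(0)` with cut-off gradient `≲ 1/(k+1)`,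
and exhaustion `k → ∞`, `t → ∞`). [cite: LemarieRieusset2016, Theorem 14.1 (proof, Step 1)] -/
theorem lintegral_frobeniusNormSq_fderiv_heatExtension_le {g : E → F'} (hg : MemLp g 2 volume) :
    ∫⁻ z in Ioi (0 : ℝ) ×ˢ (univ : Set E),
        ENNReal.ofReal (frobeniusNormSq (fderiv ℝ (heatExtension g z.1) z.2)) ≤
      eLpNorm g 2 volume ^ 2 := by
  set Eb : ℝ := (eLpNorm g 2 volume ^ 2).toReal with hEbdef
  have hEb : 0 ≤ Eb := ENNReal.toReal_nonneg
  have hEbeq : ENNReal.ofReal Eb = eLpNorm g 2 volume ^ 2 :=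
    ENNReal.ofReal_toReal (ENNReal.pow_ne_top hg.eLpNorm_ne_top)
  have hE : ∀ (x₀ : E) (τ : ℝ), 0 < τ → ∀ r : ℝ,
      ∫ x in ball x₀ r, ‖heatExtension g τ x‖ ^ 2 ≤ Eb := by
    intro x₀ τ hτ r
    have h := integral_ball_norm_heatExtension_sq_le (p := 2) le_rfl (by norm_num) hg hτ x₀ r
    have h1 : (1 : ℝ) - 2 / (2 : ℝ≥0∞).toReal = 0 := by norm_num
    rwa [h1, ENNReal.rpow_zero, one_mul] at h
  obtain ⟨C₀, hC₀, hC⟩ := exists_norm_fderiv_cutoff_le (E := E)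
  set n : ℝ := (Module.finrank ℝ E : ℝ) with hn
  set Φ : ℝ × E → ℝ≥0∞ := fun z =>
    ENNReal.ofReal (frobeniusNormSq (fderiv ℝ (heatExtension g z.1) z.2)) with hΦ
  -- Step 1: the bound on `(0, t) × E` for each `t > 0`
  have hstep : ∀ t : ℝ, 0 < t → ∫⁻ z in Ioo 0 t ×ˢ (univ : Set E), Φ z ≤ ENNReal.ofReal Eb := by
    intro t ht
    set box : ℕ → Set (ℝ × E) := fun k => Ioo (t / ((k : ℝ) + 2)) t ×ˢ ball (0 : E) ((k : ℝ) + 1)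
      with hbox
    have hbound : ∀ k : ℕ, ∫⁻ z in box k, Φ z ≤
        ENNReal.ofReal (Eb + 4 * n * (C₀ / ((k : ℝ) + 1)) ^ 2 * Eb * t) := fun k =>
      setLIntegral_box_frobeniusNormSq_fderiv_heatExtension_le hg one_le_two
        (R := (k : ℝ) + 1) (by positivity) 0 (hC _ (by positivity)) hEb (fun τ hτ => hE 0 τ hτ _)
        (by positivity) (div_le_self ht.le (by linarith [(k.cast_nonneg : (0 : ℝ) ≤ k)]))
    have hmono : Monotone box := by
      intro j k hjk
      have hjk' : (j : ℝ) ≤ k := by exact_mod_cast hjk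
      refine prod_mono (Ioo_subset_Ioo ?_ le_rfl) (ball_subset_ball (by linarith))
      exact div_le_div_of_nonneg_left ht.le (by positivity) (by linarith)
    have hcover : Ioo 0 t ×ˢ (univ : Set E) ⊆ ⋃ k, box k := by
      rintro ⟨τ, x⟩ ⟨⟨hτ0, hτt⟩, -⟩
      obtain ⟨k, hk⟩ := exists_nat_gt (max (t / τ) ‖x‖)
      refine mem_iUnion.2 ⟨k, ⟨?_, hτt⟩, ?_⟩
      · show t / ((k : ℝ) + 2) < τ
        have hk1 : t / τ < k := lt_of_le_of_lt (le_max_left _ _) hk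
        rw [div_lt_iff₀ hτ0] at hk1
        rw [div_lt_iff₀ (by positivity)]
        nlinarith
      · rw [mem_ball_zero_iff]
        linarith [lt_of_le_of_lt (le_max_right _ _) hk]
    -- the bounds tend to `Eb`
    have hlim : Tendsto (fun k : ℕ => ENNReal.ofReal (Eb + 4 * n * (C₀ / ((k : ℝ) + 1)) ^ 2 * Eb * t))
        atTop (𝓝 (ENNReal.ofReal Eb)) := by
      refine ENNReal.tendsto_ofReal ?_
      have h1 : Tendsto (fun k : ℕ => C₀ / ((k : ℝ) + 1)) atTop (𝓝 0) :=
        tendsto_const_nhds.div_atTop (tendsto_natCast_atTop_atTop.atTop_add tendsto_const_nhds)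
      have h2 : Tendsto (fun k : ℕ => Eb + 4 * n * (C₀ / ((k : ℝ) + 1)) ^ 2 * Eb * t) atTop
          (𝓝 (Eb + 4 * n * 0 ^ 2 * Eb * t)) :=
        tendsto_const_nhds.add (((tendsto_const_nhds.mul (h1.pow 2)).mul tendsto_const_nhds).mul
          tendsto_const_nhds)
      simpa using h2
    -- each box integral is below the limit of the bounds
    have hbmono : ∀ j k : ℕ, j ≤ k →
        Eb + 4 * n * (C₀ / ((k : ℝ) + 1)) ^ 2 * Eb * t ≤ Eb + 4 * n * (C₀ / ((j : ℝ) + 1)) ^ 2 * Eb * t := by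
      intro j k hjk
      have hjk' : (j : ℝ) + 1 ≤ (k : ℝ) + 1 := by exact_mod_cast Nat.succ_le_succ hjk
      have hsq : (C₀ / ((k : ℝ) + 1)) ^ 2 ≤ (C₀ / ((j : ℝ) + 1)) ^ 2 := by
        apply pow_le_pow_left₀ (by positivity)
        exact div_le_div_of_nonneg_left hC₀ (by positivity) hjk'
      have h4 : 0 ≤ 4 * n * Eb * t := by positivity
      nlinarith
    have hk : ∀ k : ℕ, ∫⁻ z in box k, Φ z ≤ ENNReal.ofReal Eb := fun k =>
      ge_of_tendsto' hlim fun j => by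
        rcases le_total k j with hkj | hjk
        · exact (lintegral_mono_set (hmono hkj)).trans (hbound j)
        · exact (hbound k).trans (ENNReal.ofReal_le_ofReal (hbmono j k hjk))
    calc ∫⁻ z in Ioo 0 t ×ˢ (univ : Set E), Φ z ≤ ∫⁻ z in ⋃ k, box k, Φ z := lintegral_mono_set hcover
      _ = ⨆ k, ∫⁻ z in box k, Φ z := setLIntegral_iUnion_of_directed _ (hmono.directed_le)
      _ ≤ ENNReal.ofReal Eb := iSup_le hk
  -- Step 2: `t → ∞`
  have hcover : Ioi (0 : ℝ) ×ˢ (univ : Set E) ⊆ ⋃ k : ℕ, Ioo 0 ((k : ℝ) + 1) ×ˢ (univ : Set E) := by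
    rintro ⟨τ, x⟩ ⟨hτ0, -⟩
    obtain ⟨k, hk⟩ := exists_nat_gt τ
    exact mem_iUnion.2 ⟨k, ⟨hτ0, by linarith⟩, mem_univ _⟩
  have hdir : Directed (· ⊆ ·) fun k : ℕ => Ioo 0 ((k : ℝ) + 1) ×ˢ (univ : Set E) :=
    Monotone.directed_le fun j k hjk => prod_mono (Ioo_subset_Ioo le_rfl (by exact_mod_cast Nat.succ_le_succ hjk))
      Subset.rfl
  calc ∫⁻ z in Ioi (0 : ℝ) ×ˢ (univ : Set E), Φ z
      ≤ ∫⁻ z in ⋃ k : ℕ, Ioo 0 ((k : ℝ) + 1) ×ˢ (univ : Set E), Φ z := lintegral_mono_set hcover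
    _ = ⨆ k : ℕ, ∫⁻ z in Ioo 0 ((k : ℝ) + 1) ×ˢ (univ : Set E), Φ z := setLIntegral_iUnion_of_directed _ hdir
    _ ≤ ENNReal.ofReal Eb := iSup_le fun k => hstep _ (by positivity)
    _ = eLpNorm g 2 volume ^ 2 := hEbeq

/-- **Energy bound for `div e^{sΔ}g`**: for `g ∈ L²(E; E)`,
`∫₀^∞ ∫ |div e^{sΔ}g|² dx ds ≤ ‖tr‖² ‖g‖²_{L²}` (`|div v| ≤ ‖tr‖ ‖Dv‖ ≤ ‖tr‖ |Dv|_F` and the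
global enstrophy bound). [cite: LemarieRieusset2016, Theorem 14.1 (proof, Step 1)] -/
theorem lintegral_divergence_heatExtension_sq_le {g : E → E} (hg : MemLp g 2 volume) :
    ∫⁻ s in Ioi (0 : ℝ), ∫⁻ x, ‖VectorCalculus.divergence (heatExtension g s) x‖ₑ ^ (2 : ℝ) ≤
      ENNReal.ofReal (‖(traceCLM : (E →L[ℝ] E) →L[ℝ] ℝ)‖ ^ 2) * eLpNorm g 2 volume ^ 2 := by
  set T : ℝ := ‖(traceCLM : (E →L[ℝ] E) →L[ℝ] ℝ)‖ with hT
  set Φ : ℝ × E → ℝ≥0∞ := fun z =>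
    ENNReal.ofReal (frobeniusNormSq (fderiv ℝ (heatExtension g z.1) z.2)) with hΦ
  -- pointwise comparison
  have hpt : ∀ (s : ℝ) (x : E), ‖VectorCalculus.divergence (heatExtension g s) x‖ₑ ^ (2 : ℝ) ≤
      ENNReal.ofReal (T ^ 2) * Φ (s, x) := by
    intro s x
    have h1 : ‖VectorCalculus.divergence (heatExtension g s) x‖ ≤ T * ‖fderiv ℝ (heatExtension g s) x‖ :=
      norm_divergence_le_traceCLM _ x
    have h2 : ‖fderiv ℝ (heatExtension g s) x‖ ^ 2 ≤ frobeniusNormSq (fderiv ℝ (heatExtension g s) x) :=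
      sq_opNorm_le_frobeniusNormSq _
    have h3 : ‖VectorCalculus.divergence (heatExtension g s) x‖ ^ 2 ≤
        T ^ 2 * frobeniusNormSq (fderiv ℝ (heatExtension g s) x) := by
      calc ‖VectorCalculus.divergence (heatExtension g s) x‖ ^ 2
          ≤ (T * ‖fderiv ℝ (heatExtension g s) x‖) ^ 2 := pow_le_pow_left₀ (norm_nonneg _) h1 2
        _ = T ^ 2 * ‖fderiv ℝ (heatExtension g s) x‖ ^ 2 := by ring
        _ ≤ T ^ 2 * frobeniusNormSq (fderiv ℝ (heatExtension g s) x) :=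
            mul_le_mul_of_nonneg_left h2 (by positivity)
    calc ‖VectorCalculus.divergence (heatExtension g s) x‖ₑ ^ (2 : ℝ)
        = ENNReal.ofReal (‖VectorCalculus.divergence (heatExtension g s) x‖ ^ 2) := by
          rw [← ofReal_norm, ENNReal.ofReal_rpow_of_nonneg (norm_nonneg _) (by norm_num), Real.rpow_two]
      _ ≤ ENNReal.ofReal (T ^ 2 * frobeniusNormSq (fderiv ℝ (heatExtension g s) x)) := ENNReal.ofReal_le_ofReal h3
      _ = ENNReal.ofReal (T ^ 2) * Φ (s, x) := by rw [hΦ, ENNReal.ofReal_mul (by positivity)]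
  -- measurability of `Φ` on `(0,∞) × E`
  have cDu : ContinuousOn (fun z : ℝ × E => fderiv ℝ (heatExtension g z.1) z.2) (Ioi 0 ×ˢ univ) :=
    continuousOn_clm_apply.2 fun v => continuousOn_uncurry_fderiv_heatExtension_of_memLp hg one_le_two v
  have hΦc : ContinuousOn Φ (Ioi 0 ×ˢ univ) :=
    ENNReal.continuous_ofReal.comp_continuousOn (LerayHopfProofs.continuous_frobeniusNormSq.comp_continuousOn cDu)
  have hΦm : AEMeasurable Φ (((volume : Measure ℝ).restrict (Ioi 0)).prod (volume : Measure E)) := by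
    rw [Measure.restrict_prod_eq_prod_univ, ← Measure.volume_eq_prod]
    exact hΦc.aemeasurable (measurableSet_Ioi.prod MeasurableSet.univ)
  calc ∫⁻ s in Ioi (0 : ℝ), ∫⁻ x, ‖VectorCalculus.divergence (heatExtension g s) x‖ₑ ^ (2 : ℝ)
      ≤ ∫⁻ s in Ioi (0 : ℝ), ∫⁻ x, ENNReal.ofReal (T ^ 2) * Φ (s, x) :=
        lintegral_mono fun s => lintegral_mono fun x => hpt s x
    _ = ENNReal.ofReal (T ^ 2) * ∫⁻ s in Ioi (0 : ℝ), ∫⁻ x, Φ (s, x) := by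
        rw [← lintegral_const_mul' _ _ ENNReal.ofReal_ne_top]
        congr 1; funext s
        rw [lintegral_const_mul' _ _ ENNReal.ofReal_ne_top]
    _ = ENNReal.ofReal (T ^ 2) * ∫⁻ z, Φ z ∂(((volume : Measure ℝ).restrict (Ioi 0)).prod (volume : Measure E)) := by
        rw [lintegral_prod _ hΦm]
    _ = ENNReal.ofReal (T ^ 2) * ∫⁻ z in Ioi (0 : ℝ) ×ˢ (univ : Set E), Φ z := by
        rw [Measure.restrict_prod_eq_prod_univ, ← Measure.volume_eq_prod]
    _ ≤ ENNReal.ofReal (T ^ 2) * eLpNorm g 2 volume ^ 2 :=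
        mul_le_mul' le_rfl (lintegral_frobeniusNormSq_fderiv_heatExtension_le hg)

/-- The same bound for the rescaled family `σ ↦ div e^{(σ/2)Δ}g`:
`∫₀^∞ ∫ |div e^{(σ/2)Δ}g|² dx dσ ≤ 2‖tr‖² ‖g‖²_{L²}` (change of variables `σ = 2s`). [folklore] -/
theorem lintegral_divergence_heatExtension_half_sq_le {g : E → E} (hg : MemLp g 2 volume) :
    ∫⁻ σ in Ioi (0 : ℝ), ∫⁻ x, ‖VectorCalculus.divergence (heatExtension g (σ / 2)) x‖ₑ ^ (2 : ℝ) ≤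
      2 * (ENNReal.ofReal (‖(traceCLM : (E →L[ℝ] E) →L[ℝ] ℝ)‖ ^ 2) * eLpNorm g 2 volume ^ 2) := by
  set H : ℝ → ℝ≥0∞ := fun s => (Ioi (0 : ℝ)).indicator
    (fun s => ∫⁻ x, ‖VectorCalculus.divergence (heatExtension g s) x‖ₑ ^ (2 : ℝ)) s with hH
  have hind : ∀ σ : ℝ, (Ioi (0 : ℝ)).indicator
      (fun σ => ∫⁻ x, ‖VectorCalculus.divergence (heatExtension g (σ / 2)) x‖ₑ ^ (2 : ℝ)) σ = H (2⁻¹ * σ) := by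
    intro σ
    by_cases hσ : 0 < σ
    · have h2 : 0 < 2⁻¹ * σ := by positivity
      rw [indicator_of_mem (show σ ∈ Ioi (0:ℝ) from hσ), hH]
      simp only [indicator_of_mem (show 2⁻¹ * σ ∈ Ioi (0:ℝ) from h2), div_eq_inv_mul]
    · have h2 : ¬ (0 < 2⁻¹ * σ) := fun h => hσ (by linarith)
      rw [indicator_of_notMem (show σ ∉ Ioi (0:ℝ) from hσ), hH]
      simp only [indicator_of_notMem (show 2⁻¹ * σ ∉ Ioi (0:ℝ) from h2)]
  set e : ℝ ≃ᵐ ℝ := (Homeomorph.mulLeft₀ (2⁻¹ : ℝ) (by norm_num)).toMeasurableEquiv with he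
  have hmap : Measure.map e (volume : Measure ℝ) = ENNReal.ofReal |(2⁻¹ : ℝ)⁻¹| • (volume : Measure ℝ) := by
    have : (e : ℝ → ℝ) = fun σ => 2⁻¹ * σ := rfl
    rw [this]; exact Real.map_volume_mul_left (by norm_num)
  calc ∫⁻ σ in Ioi (0 : ℝ), ∫⁻ x, ‖VectorCalculus.divergence (heatExtension g (σ / 2)) x‖ₑ ^ (2 : ℝ)
      = ∫⁻ σ, (Ioi (0 : ℝ)).indicator
          (fun σ => ∫⁻ x, ‖VectorCalculus.divergence (heatExtension g (σ / 2)) x‖ₑ ^ (2 : ℝ)) σ :=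
        (lintegral_indicator measurableSet_Ioi _).symm
    _ = ∫⁻ σ, H (e σ) := by congr 1; funext σ; exact hind σ
    _ = ∫⁻ s, H s ∂(Measure.map e volume) := (lintegral_map_equiv H e).symm
    _ = 2 * ∫⁻ s, H s := by
        rw [hmap, lintegral_smul_measure]
        norm_num
    _ = 2 * ∫⁻ s in Ioi (0 : ℝ), ∫⁻ x, ‖VectorCalculus.divergence (heatExtension g s) x‖ₑ ^ (2 : ℝ) := by
        rw [hH, lintegral_indicator measurableSet_Ioi]
    _ ≤ 2 * (ENNReal.ofReal (‖(traceCLM : (E →L[ℝ] E) →L[ℝ] ℝ)‖ ^ 2) * eLpNorm g 2 volume ^ 2) :=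
        mul_le_mul' le_rfl (lintegral_divergence_heatExtension_sq_le hg)

end Enstrophy

/-! ### The pairing identity and the `L²` bound of `∫_ε^R ∇div e^{σΔ}g dσ` -/

section Pairing

variable {g h : E → E}

/-- **Pairing identity**: for bounded measurable `g ∈ L²`, `h ∈ L²` and `σ > 0`,
`∫⟪∇div e^{σΔ}g, h⟫ = -∫ (div e^{(σ/2)Δ}g)(div e^{(σ/2)Δ}h)` (write
`∇div e^{σΔ}g = e^{(σ/2)Δ}∇d`, `d = div e^{(σ/2)Δ}g`, move `e^{(σ/2)Δ}` onto `h` by the symmetry of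
the heat semigroup, and integrate by parts on the whole space). [folklore] -/
theorem integral_inner_gradDiv_heatExtension_eq (hg : MemLp g 2 volume) {K : ℝ}
    (hK : ∀ z, ‖g z‖ ≤ K) (hh : MemLp h 2 volume) {σ : ℝ} (hσ : 0 < σ) :
    ∫ x, ⟪gradient (VectorCalculus.divergence (heatExtension g σ)) x, h x⟫ =
      -∫ x, VectorCalculus.divergence (heatExtension g (σ / 2)) x *
        VectorCalculus.divergence (heatExtension h (σ / 2)) x := by
  haveI : CompleteSpace E := FiniteDimensional.complete ℝ E
  have ha : 0 < σ / 2 := by positivity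
  have heq : σ = σ / 2 + σ / 2 := by ring
  obtain ⟨C₁, hC₁⟩ := eLpNorm_divergence_heatExtension_le (E := E) (p := 2) one_le_two
  obtain ⟨hdmem, -⟩ := hC₁ g hg (σ / 2) ha
  obtain ⟨hdhmem, -⟩ := hC₁ h hh (σ / 2) ha
  obtain ⟨C₂, hC₂⟩ := eLpNorm_gradDiv_heatExtension_le (E := E) (p := 2) one_le_two (q := 2) le_rfl
  obtain ⟨hImem, -⟩ := hC₂ g hg K hK (σ / 2) ha
  obtain ⟨hsm, B, hB⟩ := heatExtension_bounds_of_bound hg.1 hK ha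
  have hsm2 : ContDiff ℝ 2 (heatExtension g (σ / 2)) := contDiff_infty.1 hsm 2
  have hd1 : ContDiff ℝ 1 (VectorCalculus.divergence (heatExtension g (σ / 2))) :=
    contDiff_divergence_of_contDiff_succ (n := 1) hsm2
  -- `∇div e^{σΔ}g = e^{(σ/2)Δ} ∇d`
  have hI : ∀ x, gradient (VectorCalculus.divergence (heatExtension g σ)) x =
      heatExtension (gradient (VectorCalculus.divergence (heatExtension g (σ / 2)))) (σ / 2) x := fun x => by
    conv_lhs => rw [heq]
    exact gradDiv_heatExtension_semigroup hg.1 hK ha ha x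
  -- symmetry of the heat semigroup
  have h1 : ∫ x, ⟪gradient (VectorCalculus.divergence (heatExtension g σ)) x, h x⟫ =
      ∫ x, ⟪gradient (VectorCalculus.divergence (heatExtension g (σ / 2))) x, heatExtension h (σ / 2) x⟫ := by
    simp_rw [hI]
    exact (integral_inner_heatExtension_comm (p := 2) (q := 2) hImem hh ha).symm
  -- integration by parts on the whole space
  set V : E → E := heatExtension h (σ / 2) with hV
  have hVsm : ContDiff ℝ 1 V := contDiff_infty.1 (contDiff_heatExtension_holds hh one_le_two ha) 1
  have hVmem : MemLp V 2 volume := memLp_heatExtension_holds hh one_le_two ha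
  have hint : Integrable (fun x => VectorCalculus.divergence (heatExtension g (σ / 2)) x • V x) := by
    have h := MemLp.smul (r := 1) hVmem hdmem
    exact memLp_one_iff_integrable.1 h
  have hi1 : Integrable (fun x => VectorCalculus.divergence (heatExtension g (σ / 2)) x *
      VectorCalculus.divergence V x) := by
    have h := MemLp.mul (r := 1) hdhmem hdmem
    exact memLp_one_iff_integrable.1 h
  have hi2 : Integrable (fun x => ⟪V x, gradient (VectorCalculus.divergence (heatExtension g (σ / 2))) x⟫) :=
    integrable_inner_of_memLp_two hVmem hImem
  have hibp := integral_mul_divergence_add_eq_zero_of_integrable hd1 hVsm hint hi1 hi2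
  have h2 : ∫ x, ⟪gradient (VectorCalculus.divergence (heatExtension g (σ / 2))) x, V x⟫ =
      ∫ x, ⟪V x, gradient (VectorCalculus.divergence (heatExtension g (σ / 2))) x⟫ :=
    integral_congr_ae (Eventually.of_forall fun x => real_inner_comm _ _)
  rw [h1, h2]
  linarith

/-- **Pointwise-in-`σ` bound of the pairing**: for every `λ > 0`,
`|∫⟪∇div e^{σΔ}g, h⟫| ≤ ½(λ ∫|div e^{(σ/2)Δ}g|² + λ⁻¹ ∫|div e^{(σ/2)Δ}h|²)` (the pairing identity and
`|ab| ≤ ½(λa² + λ⁻¹b²)`). [folklore] -/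
theorem abs_integral_inner_gradDiv_heatExtension_le (hg : MemLp g 2 volume) {K : ℝ}
    (hK : ∀ z, ‖g z‖ ≤ K) (hh : MemLp h 2 volume) {σ : ℝ} (hσ : 0 < σ) {lam : ℝ} (hlam : 0 < lam) :
    |∫ x, ⟪gradient (VectorCalculus.divergence (heatExtension g σ)) x, h x⟫| ≤
      (lam * (∫ x, ‖VectorCalculus.divergence (heatExtension g (σ / 2)) x‖ ^ 2) +
        lam⁻¹ * (∫ x, ‖VectorCalculus.divergence (heatExtension h (σ / 2)) x‖ ^ 2)) / 2 := by
  have ha : 0 < σ / 2 := by positivity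
  obtain ⟨C₁, hC₁⟩ := eLpNorm_divergence_heatExtension_le (E := E) (p := 2) one_le_two
  obtain ⟨hdmem, -⟩ := hC₁ g hg (σ / 2) ha
  obtain ⟨hdhmem, -⟩ := hC₁ h hh (σ / 2) ha
  set dg : E → ℝ := VectorCalculus.divergence (heatExtension g (σ / 2)) with hdg
  set dh : E → ℝ := VectorCalculus.divergence (heatExtension h (σ / 2)) with hdh
  have hig : Integrable fun x => ‖dg x‖ ^ 2 := (memLp_two_iff_integrable_sq_norm hdmem.1).1 hdmem
  have hih : Integrable fun x => ‖dh x‖ ^ 2 := (memLp_two_iff_integrable_sq_norm hdhmem.1).1 hdhmem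
  rw [integral_inner_gradDiv_heatExtension_eq hg hK hh hσ, abs_neg]
  have hpt : ∀ x, |dg x * dh x| ≤ (lam * ‖dg x‖ ^ 2 + lam⁻¹ * ‖dh x‖ ^ 2) / 2 := by
    intro x
    rw [abs_mul, Real.norm_eq_abs, Real.norm_eq_abs]
    have hl : 0 < lam⁻¹ := inv_pos.2 hlam
    have key : 0 ≤ (lam * |dg x| - |dh x|) ^ 2 := sq_nonneg _
    have : |dg x| * |dh x| = (lam * |dg x|) * |dh x| * lam⁻¹ := by
      field_simp
    rw [this]
    have h2 : (lam * |dg x| ^ 2 + lam⁻¹ * |dh x| ^ 2) / 2 =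
        ((lam * |dg x|) ^ 2 + |dh x| ^ 2) * lam⁻¹ / 2 := by
      field_simp
      try ring
    rw [h2]
    have hnn : 0 ≤ lam⁻¹ := hl.le
    nlinarith [mul_nonneg key hnn]
  calc |∫ x, dg x * dh x| ≤ ∫ x, |dg x * dh x| := abs_integral_le_integral_abs
    _ ≤ ∫ x, (lam * ‖dg x‖ ^ 2 + lam⁻¹ * ‖dh x‖ ^ 2) / 2 := by
        refine integral_mono_of_nonneg (Eventually.of_forall fun x => abs_nonneg _)
          (((hig.const_mul lam).add (hih.const_mul lam⁻¹)).div_const 2) (Eventually.of_forall hpt)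
    _ = (lam * (∫ x, ‖dg x‖ ^ 2) + lam⁻¹ * (∫ x, ‖dh x‖ ^ 2)) / 2 := by
        rw [integral_div, integral_add (hig.const_mul lam) (hih.const_mul lam⁻¹), integral_const_mul,
          integral_const_mul]

/-- The real `σ`-integral of `∫|div e^{(σ/2)Δ}g|²` over `(ε, R]` is at most `2‖tr‖²‖g‖²_{L²}`
(measurability from joint continuity; the `lintegral` bound
`lintegral_divergence_heatExtension_half_sq_le`). [folklore] -/
theorem integral_Ioc_integral_divergence_sq_le (hg : MemLp g 2 volume) {K : ℝ} (hK : ∀ z, ‖g z‖ ≤ K)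
    {ε R : ℝ} (hε : 0 < ε) :
    IntegrableOn (fun σ => ∫ x, ‖VectorCalculus.divergence (heatExtension g (σ / 2)) x‖ ^ 2) (Ioc ε R) ∧
    ∫ σ in Ioc ε R, ∫ x, ‖VectorCalculus.divergence (heatExtension g (σ / 2)) x‖ ^ 2 ≤
      2 * ‖(traceCLM : (E →L[ℝ] E) →L[ℝ] ℝ)‖ ^ 2 * (eLpNorm g 2 volume).toReal ^ 2 := by
  set T : ℝ := ‖(traceCLM : (E →L[ℝ] E) →L[ℝ] ℝ)‖ with hT
  obtain ⟨C₁, hC₁⟩ := eLpNorm_divergence_heatExtension_le (E := E) (p := 2) one_le_two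
  set A : ℝ → ℝ := fun σ => ∫ x, ‖VectorCalculus.divergence (heatExtension g (σ / 2)) x‖ ^ 2 with hA
  -- `A σ = (∫⁻ ‖d‖ₑ²).toReal`, finite, and bounded on `(ε, R]`
  have hAeq : ∀ σ : ℝ, 0 < σ → ENNReal.ofReal (A σ) =
      ∫⁻ x, ‖VectorCalculus.divergence (heatExtension g (σ / 2)) x‖ₑ ^ (2 : ℝ) := by
    intro σ hσ
    obtain ⟨hdmem, -⟩ := hC₁ g hg (σ / 2) (by positivity)
    have hig : Integrable fun x => ‖VectorCalculus.divergence (heatExtension g (σ / 2)) x‖ ^ 2 :=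
      (memLp_two_iff_integrable_sq_norm hdmem.1).1 hdmem
    rw [hA, ofReal_integral_eq_lintegral_ofReal hig (Eventually.of_forall fun x => by positivity)]
    refine lintegral_congr fun x => ?_
    rw [← ofReal_norm, ENNReal.ofReal_rpow_of_nonneg (norm_nonneg _) (by norm_num), Real.rpow_two]
  have hAbound : ∀ σ ∈ Ioc ε R, ‖A σ‖ ≤ (C₁ : ℝ) ^ 2 * (ε / 2) ^ (-(1 : ℝ)) * (eLpNorm g 2 volume).toReal ^ 2 := by
    intro σ hσ
    have hσ0 : 0 < σ := hε.trans_le hσ.1.le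
    have ha : 0 < σ / 2 := by positivity
    obtain ⟨hdmem, hdle⟩ := hC₁ g hg (σ / 2) ha
    have hig : Integrable fun x => ‖VectorCalculus.divergence (heatExtension g (σ / 2)) x‖ ^ 2 :=
      (memLp_two_iff_integrable_sq_norm hdmem.1).1 hdmem
    have hAnn : 0 ≤ A σ := integral_nonneg fun x => by positivity
    rw [Real.norm_of_nonneg hAnn]
    -- `A σ = ‖d‖₂²`
    have hA2 : A σ = (eLpNorm (VectorCalculus.divergence (heatExtension g (σ / 2))) 2 volume).toReal ^ 2 := by
      have h := hdmem.eLpNorm_eq_integral_rpow_norm (by norm_num) (by norm_num)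
      simp only [ENNReal.toReal_ofNat, Real.rpow_two] at h
      rw [h, ENNReal.toReal_ofReal (by positivity), ← Real.rpow_natCast _ 2,
        ← Real.rpow_mul (integral_nonneg fun x => by positivity)]
      norm_num
      simp only [hA, Real.norm_eq_abs, sq_abs]
    rw [hA2]
    have hle : (eLpNorm (VectorCalculus.divergence (heatExtension g (σ / 2))) 2 volume).toReal ≤
        C₁ * (σ / 2) ^ (-(1 / 2 : ℝ)) * (eLpNorm g 2 volume).toReal := by
      have h := ENNReal.toReal_mono (ENNReal.mul_ne_top (ENNReal.mul_ne_top ENNReal.coe_ne_top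
        ENNReal.ofReal_ne_top) hg.eLpNorm_ne_top) hdle
      rwa [ENNReal.toReal_mul, ENNReal.toReal_mul, ENNReal.coe_toReal,
        ENNReal.toReal_ofReal (Real.rpow_nonneg ha.le _)] at h
    have hmono : (σ / 2) ^ (-(1 / 2 : ℝ)) ≤ (ε / 2) ^ (-(1 / 2 : ℝ)) :=
      Real.rpow_le_rpow_of_nonpos (by positivity) (by linarith [hσ.1]) (by norm_num)
    have hsq : ((ε / 2) ^ (-(1 / 2 : ℝ))) ^ 2 = (ε / 2) ^ (-(1 : ℝ)) := by
      rw [← Real.rpow_natCast _ 2, ← Real.rpow_mul (by positivity)]; norm_num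
    calc (eLpNorm (VectorCalculus.divergence (heatExtension g (σ / 2))) 2 volume).toReal ^ 2
        ≤ (C₁ * (σ / 2) ^ (-(1 / 2 : ℝ)) * (eLpNorm g 2 volume).toReal) ^ 2 :=
          pow_le_pow_left₀ ENNReal.toReal_nonneg hle 2
      _ ≤ (C₁ * (ε / 2) ^ (-(1 / 2 : ℝ)) * (eLpNorm g 2 volume).toReal) ^ 2 := by
          apply pow_le_pow_left₀ (by positivity)
          gcongr
      _ = (C₁ : ℝ) ^ 2 * (ε / 2) ^ (-(1 : ℝ)) * (eLpNorm g 2 volume).toReal ^ 2 := by rw [← hsq]; ring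
  -- measurability of `A` on `(ε, R]`: `A = toReal ∘ (σ ↦ ∫⁻ ‖d(σ/2)‖ₑ²)`
  have hcont : ContinuousOn (fun q : ℝ × E => VectorCalculus.divergence (heatExtension g (q.1 / 2)) q.2)
      (Ioi 0 ×ˢ univ) := by
    refine (continuousOn_divergence_heatExtension_uncurry hg.1 hK).comp
      (f := fun q : ℝ × E => (q.1 / 2, q.2)) (by fun_prop) fun q hq => ?_
    obtain ⟨hq1, -⟩ := mem_prod.1 hq
    exact mk_mem_prod (show 0 < q.1 / 2 from half_pos hq1) (mem_univ _)
  have hFm : AEMeasurable (fun q : ℝ × E => ‖VectorCalculus.divergence (heatExtension g (q.1 / 2)) q.2‖ₑ ^ (2 : ℝ))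
      (((volume : Measure ℝ).restrict (Ioi 0)).prod (volume : Measure E)) := by
    rw [Measure.restrict_prod_eq_prod_univ, ← Measure.volume_eq_prod]
    exact ((hcont.aestronglyMeasurable (measurableSet_Ioi.prod MeasurableSet.univ)).enorm.pow_const _)
  have hLm : AEMeasurable (fun σ => ∫⁻ x, ‖VectorCalculus.divergence (heatExtension g (σ / 2)) x‖ₑ ^ (2 : ℝ))
      ((volume : Measure ℝ).restrict (Ioi 0)) := hFm.lintegral_prod_right'
  have hAm : AEStronglyMeasurable A ((volume : Measure ℝ).restrict (Ioc ε R)) := by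
    have hsub : Ioc ε R ⊆ Ioi 0 := fun σ hσ => hε.trans_le hσ.1.le
    have h1 : AEMeasurable (fun σ => (∫⁻ x, ‖VectorCalculus.divergence (heatExtension g (σ / 2)) x‖ₑ ^ (2 : ℝ)).toReal)
        ((volume : Measure ℝ).restrict (Ioc ε R)) :=
      (hLm.mono_measure (Measure.restrict_mono hsub le_rfl)).ennreal_toReal
    refine (h1.aestronglyMeasurable).congr ?_
    filter_upwards [ae_restrict_mem measurableSet_Ioc] with σ hσ
    have hσ0 : 0 < σ := hε.trans_le hσ.1.le
    rw [← hAeq σ hσ0, ENNReal.toReal_ofReal (integral_nonneg fun x => by positivity)]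
  have hAint : IntegrableOn A (Ioc ε R) := by
    haveI : IsFiniteMeasure ((volume : Measure ℝ).restrict (Ioc ε R)) := ⟨by
      rw [Measure.restrict_apply_univ, Real.volume_Ioc]; exact ENNReal.ofReal_lt_top⟩
    exact Integrable.of_bound hAm _ ((ae_restrict_mem measurableSet_Ioc).mono hAbound)
  refine ⟨hAint, ?_⟩
  -- the bound through the `lintegral` form
  have hAnn : ∀ σ ∈ Ioc ε R, 0 ≤ A σ := fun σ _ => integral_nonneg fun x => by positivity
  have key : ENNReal.ofReal (∫ σ in Ioc ε R, A σ) ≤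
      ENNReal.ofReal (2 * T ^ 2 * (eLpNorm g 2 volume).toReal ^ 2) := by
    rw [ofReal_integral_eq_lintegral_ofReal hAint ((ae_restrict_mem measurableSet_Ioc).mono hAnn)]
    calc ∫⁻ σ in Ioc ε R, ENNReal.ofReal (A σ)
        = ∫⁻ σ in Ioc ε R, ∫⁻ x, ‖VectorCalculus.divergence (heatExtension g (σ / 2)) x‖ₑ ^ (2 : ℝ) := by
          refine setLIntegral_congr_fun measurableSet_Ioc fun σ hσ => hAeq σ (hε.trans_le hσ.1.le)
      _ ≤ ∫⁻ σ in Ioi (0 : ℝ), ∫⁻ x, ‖VectorCalculus.divergence (heatExtension g (σ / 2)) x‖ₑ ^ (2 : ℝ) :=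
          lintegral_mono_set fun σ hσ => hε.trans_le hσ.1.le
      _ ≤ 2 * (ENNReal.ofReal (T ^ 2) * eLpNorm g 2 volume ^ 2) := lintegral_divergence_heatExtension_half_sq_le hg
      _ = ENNReal.ofReal (2 * T ^ 2 * (eLpNorm g 2 volume).toReal ^ 2) := by
          rw [ENNReal.ofReal_mul (by positivity), ENNReal.ofReal_mul (by positivity), ENNReal.ofReal_ofNat,
            ENNReal.ofReal_pow ENNReal.toReal_nonneg, ENNReal.ofReal_toReal hg.eLpNorm_ne_top, mul_assoc]
  exact (ENNReal.ofReal_le_ofReal_iff (by positivity)).1 key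

end Pairing

section L2Bound

variable {g h : E → E}

/-- **Uniform bounds of `∇div e^{σΔ}g` for `σ ≥ ε`**: sup bound and `L²` bound (the decay
bounds of the calculus file, monotone in `σ`). [cite: GigaGigaSaal2010, §1.1.3] -/
theorem gradDiv_heatExtension_bounds_of_le (hg : MemLp g 2 volume) {K : ℝ} (hK : ∀ z, ‖g z‖ ≤ K)
    {ε : ℝ} (hε : 0 < ε) :
    ∃ B : ℝ, ∃ B₂ : ℝ≥0∞, 0 ≤ B ∧ B₂ < ∞ ∧ ∀ σ : ℝ, ε ≤ σ →
      (∀ x, ‖gradient (VectorCalculus.divergence (heatExtension g σ)) x‖ ≤ B) ∧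
      MemLp (gradient (VectorCalculus.divergence (heatExtension g σ))) 2 volume ∧
      eLpNorm (gradient (VectorCalculus.divergence (heatExtension g σ))) 2 volume ≤ B₂ := by
  obtain ⟨C, hC0, hC⟩ := norm_gradDiv_heatExtension_le (E := E) (p := 2) one_le_two
  obtain ⟨C₂, hC₂⟩ := eLpNorm_gradDiv_heatExtension_le (E := E) (p := 2) one_le_two (q := 2) le_rfl
  set e₁ : ℝ := -(1 + (Module.finrank ℝ E : ℝ) / 2 * (1 / (2 : ℝ≥0∞)).toReal) with he₁
  set e₂ : ℝ := -(1 + (Module.finrank ℝ E : ℝ) / 2 * ((1 / (2 : ℝ≥0∞)).toReal - (1 / (2 : ℝ≥0∞)).toReal)) with he₂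
  have he₁0 : e₁ ≤ 0 := by
    rw [he₁]; simp only [one_div, ENNReal.toReal_inv, ENNReal.toReal_ofNat]
    have : (0 : ℝ) ≤ (Module.finrank ℝ E : ℝ) := Nat.cast_nonneg _
    nlinarith
  have he₂0 : e₂ ≤ 0 := by rw [he₂]; simp
  refine ⟨C * ε ^ e₁ * (eLpNorm g 2 volume).toReal, C₂ * ENNReal.ofReal (ε ^ e₂) * eLpNorm g 2 volume,
    by positivity, ENNReal.mul_lt_top (ENNReal.mul_lt_top ENNReal.coe_lt_top ENNReal.ofReal_lt_top)
      hg.eLpNorm_lt_top, fun σ hσ => ?_⟩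
  have hσ0 : 0 < σ := hε.trans_le hσ
  have hpow₁ : σ ^ e₁ ≤ ε ^ e₁ := Real.rpow_le_rpow_of_nonpos hε hσ he₁0
  have hpow₂ : σ ^ e₂ ≤ ε ^ e₂ := Real.rpow_le_rpow_of_nonpos hε hσ he₂0
  obtain ⟨hImem, hIle⟩ := hC₂ g hg K hK σ hσ0
  refine ⟨fun x => (hC g hg K hK σ hσ0 x).trans ?_, hImem, hIle.trans ?_⟩
  · exact mul_le_mul_of_nonneg_right (mul_le_mul_of_nonneg_left hpow₁ hC0) ENNReal.toReal_nonneg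
  · gcongr

/-- **Measurability and integrability data of `(x, σ) ↦ ∇div e^{σΔ}g (x)` on `E × (ε, R]`.** [folklore] -/
theorem aestronglyMeasurable_gradDiv_heatExtension_prod (hg : MemLp g 2 volume) {K : ℝ}
    (hK : ∀ z, ‖g z‖ ≤ K) {ε R : ℝ} (hε : 0 < ε) :
    AEStronglyMeasurable (uncurry fun (x : E) (σ : ℝ) => gradient (VectorCalculus.divergence (heatExtension g σ)) x)
      ((volume : Measure E).prod ((volume : Measure ℝ).restrict (Ioc ε R))) := by
  have hc0 := continuousOn_gradDiv_heatExtension_uncurry hg.1 hK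
  have h2 : ContinuousOn
      ((fun q : ℝ × E => gradient (VectorCalculus.divergence (heatExtension g q.1)) q.2) ∘
        (Prod.swap : E × ℝ → ℝ × E)) ((univ : Set E) ×ˢ Ioi (0 : ℝ)) :=
    hc0.comp continuous_swap.continuousOn fun q hq => mk_mem_prod (mem_prod.1 hq).2 (mem_univ _)
  have hc : ContinuousOn (uncurry fun (x : E) (σ : ℝ) => gradient (VectorCalculus.divergence (heatExtension g σ)) x)
      ((univ : Set E) ×ˢ Ioi (0 : ℝ)) :=
    h2.congr fun q _ => rfl
  set ρ : Measure (E × ℝ) := (volume : Measure E).prod ((volume : Measure ℝ).restrict (Ioc ε R)) with hρ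
  have h := hc.aestronglyMeasurable (μ := ρ) (MeasurableSet.univ.prod measurableSet_Ioi)
  -- `ρ` is carried by `univ × (0, ∞)`
  have hnull : ρ ((univ : Set E) ×ˢ Ioi (0 : ℝ))ᶜ = 0 := by
    have hc' : ((univ : Set E) ×ˢ Ioi (0 : ℝ))ᶜ = (univ : Set E) ×ˢ (Ioi (0 : ℝ))ᶜ := by
      ext q; simp
    rw [hc', hρ, Measure.prod_prod, Measure.restrict_apply (measurableSet_Ioi.compl)]
    have he : (Ioi (0 : ℝ))ᶜ ∩ Ioc ε R = ∅ := by
      ext σ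
      simp only [mem_inter_iff, mem_compl_iff, mem_Ioi, not_lt, mem_Ioc, mem_empty_iff_false, iff_false,
        not_and, not_le]
      intro h0 h1; linarith
    rw [he, measure_empty, mul_zero]
  have hρeq : ρ.restrict ((univ : Set E) ×ˢ Ioi (0 : ℝ)) = ρ :=
    Measure.restrict_eq_self_of_ae_mem (mem_ae_iff.2 hnull)
  rwa [hρeq] at h

/-- **The truncated corrector `x ↦ ∫_{(ε,R]} ∇div e^{σΔ}g dσ` is bounded, measurable and in `L²`**
(Minkowski's integral inequality in `σ`). [folklore] -/
theorem memLp_integral_gradDiv_heatExtension (hg : MemLp g 2 volume) {K : ℝ} (hK : ∀ z, ‖g z‖ ≤ K)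
    {ε R : ℝ} (hε : 0 < ε) :
    MemLp (fun x => ∫ σ in Ioc ε R, gradient (VectorCalculus.divergence (heatExtension g σ)) x) 2 volume ∧
    ∃ B : ℝ, ∀ x, ‖∫ σ in Ioc ε R, gradient (VectorCalculus.divergence (heatExtension g σ)) x‖ ≤ B := by
  obtain ⟨B, B₂, hB0, hB₂, hB⟩ := gradDiv_heatExtension_bounds_of_le hg hK hε
  have hmeas := aestronglyMeasurable_gradDiv_heatExtension_prod (R := R) hg hK hε
  haveI : IsFiniteMeasure ((volume : Measure ℝ).restrict (Ioc ε R)) := ⟨by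
    rw [Measure.restrict_apply_univ, Real.volume_Ioc]; exact ENNReal.ofReal_lt_top⟩
  have hF : AEStronglyMeasurable
      (fun x => ∫ σ in Ioc ε R, gradient (VectorCalculus.divergence (heatExtension g σ)) x) volume :=
    hmeas.integral_prod_right'
  -- Minkowski
  have hmink := FunctionSpaces.eLpNorm_integral_le_lintegral_eLpNorm
    (μ := (volume : Measure E)) (ν := (volume : Measure ℝ).restrict (Ioc ε R)) hmeas one_le_two
    (by norm_num : (2 : ℝ≥0∞) ≠ ∞)
  have hbound : ∫⁻ σ in Ioc ε R, eLpNorm (fun x => gradient (VectorCalculus.divergence (heatExtension g σ)) x) 2 volume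
      ≤ B₂ * volume (Ioc ε R) := by
    calc ∫⁻ σ in Ioc ε R, eLpNorm (fun x => gradient (VectorCalculus.divergence (heatExtension g σ)) x) 2 volume
        ≤ ∫⁻ _ in Ioc ε R, B₂ :=
          lintegral_mono_ae ((ae_restrict_mem measurableSet_Ioc).mono fun σ hσ => (hB σ hσ.1.le).2.2)
      _ = B₂ * volume (Ioc ε R) := setLIntegral_const _ _
  refine ⟨⟨hF, ?_⟩, ⟨B * (volume : Measure ℝ).real (Ioc ε R), fun x => ?_⟩⟩
  · refine lt_of_le_of_lt (hmink.trans hbound) (ENNReal.mul_lt_top hB₂ ?_)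
    rw [Real.volume_Ioc]; exact ENNReal.ofReal_lt_top
  · exact norm_setIntegral_le_of_norm_le_const (μ := (volume : Measure ℝ)) (s := Ioc ε R)
      (f := fun σ => gradient (VectorCalculus.divergence (heatExtension g σ)) x)
      (by rw [Real.volume_Ioc]; exact ENNReal.ofReal_lt_top) (fun σ hσ => (hB σ hσ.1.le).1 x)

/-- **The pairing of the truncated corrector with an `L²` field**:
`|∫⟪∫_{(ε,R]} ∇div e^{σΔ}g dσ, h⟫| ≤ ‖tr‖² (λ‖g‖² + λ⁻¹‖h‖²)` for every `λ > 0` (Fubini, the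
pointwise-in-`σ` bound, and the energy bound `∫₀^∞‖div e^{(σ/2)Δ}f‖² dσ ≤ 2‖tr‖²‖f‖²`). [folklore] -/
theorem abs_integral_inner_integral_gradDiv_le (hg : MemLp g 2 volume) {K : ℝ} (hK : ∀ z, ‖g z‖ ≤ K)
    (hh : MemLp h 2 volume) {K' : ℝ} (hK' : ∀ z, ‖h z‖ ≤ K') {ε R : ℝ} (hε : 0 < ε)
    {lam : ℝ} (hlam : 0 < lam) :
    |∫ x, ⟪∫ σ in Ioc ε R, gradient (VectorCalculus.divergence (heatExtension g σ)) x, h x⟫| ≤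
      ‖(traceCLM : (E →L[ℝ] E) →L[ℝ] ℝ)‖ ^ 2 *
        (lam * (eLpNorm g 2 volume).toReal ^ 2 + lam⁻¹ * (eLpNorm h 2 volume).toReal ^ 2) := by
  set T : ℝ := ‖(traceCLM : (E →L[ℝ] E) →L[ℝ] ℝ)‖ with hT
  set I : ℝ → E → E := fun σ x => gradient (VectorCalculus.divergence (heatExtension g σ)) x with hI
  obtain ⟨B, B₂, hB0, hB₂, hB⟩ := gradDiv_heatExtension_bounds_of_le hg hK hε
  have hmeas := aestronglyMeasurable_gradDiv_heatExtension_prod (R := R) hg hK hε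
  haveI : IsFiniteMeasure ((volume : Measure ℝ).restrict (Ioc ε R)) := ⟨by
    rw [Measure.restrict_apply_univ, Real.volume_Ioc]; exact ENNReal.ofReal_lt_top⟩
  -- the integrand of the double integral
  set H : E × ℝ → ℝ := fun q => ⟪I q.2 q.1, h q.1⟫ with hH
  have hHm : AEStronglyMeasurable H ((volume : Measure E).prod ((volume : Measure ℝ).restrict (Ioc ε R))) :=
    hmeas.inner (hh.1.comp_fst)
  -- slices in `x` are integrable, with integral of norms bounded
  have hslice : ∀ σ ∈ Ioc ε R, Integrable (fun x => H (x, σ)) (volume : Measure E) := fun σ hσ =>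
    integrable_inner_of_memLp_two (hB σ hσ.1.le).2.1 hh
  have hnormint : ∀ σ ∈ Ioc ε R, ∫ x, ‖H (x, σ)‖ ≤ B₂.toReal * (eLpNorm h 2 volume).toReal := by
    intro σ hσ
    obtain ⟨-, hImem, hIle⟩ := hB σ hσ.1.le
    have hpq : Real.HolderConjugate (2 : ℝ) 2 := ⟨by norm_num, by norm_num, by norm_num⟩
    have h1 := integral_mul_norm_le_Lp_mul_Lq (μ := (volume : Measure E)) hpq
      (f := I σ) (g := h) (by simpa using hImem) (by simpa using hh)
    have e1 : (∫ x, ‖I σ x‖ ^ (2 : ℝ)) ^ (1 / (2 : ℝ)) = (eLpNorm (I σ) 2 volume).toReal := by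
      rw [hImem.eLpNorm_eq_integral_rpow_norm (by norm_num) (by norm_num), ENNReal.toReal_ofReal (by positivity)]
      norm_num
      simp only [hI]
    have e2 : (∫ x, ‖h x‖ ^ (2 : ℝ)) ^ (1 / (2 : ℝ)) = (eLpNorm h 2 volume).toReal := by
      rw [hh.eLpNorm_eq_integral_rpow_norm (by norm_num) (by norm_num), ENNReal.toReal_ofReal (by positivity)]
      norm_num
    rw [e1, e2] at h1
    calc ∫ x, ‖H (x, σ)‖ ≤ ∫ x, ‖I σ x‖ * ‖h x‖ := by
          refine integral_mono_of_nonneg (Eventually.of_forall fun x => norm_nonneg _) ?_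
            (Eventually.of_forall fun x => ?_)
          · have := MemLp.mul (r := 1) hh.norm hImem.norm
            simpa [hI, memLp_one_iff_integrable, Pi.mul_def] using this
          · simp only [hH, Real.norm_eq_abs]; exact abs_real_inner_le_norm _ _
      _ ≤ (eLpNorm (I σ) 2 volume).toReal * (eLpNorm h 2 volume).toReal := h1
      _ ≤ B₂.toReal * (eLpNorm h 2 volume).toReal :=
          mul_le_mul_of_nonneg_right (ENNReal.toReal_mono hB₂.ne hIle) ENNReal.toReal_nonneg
  have hHint : Integrable H ((volume : Measure E).prod ((volume : Measure ℝ).restrict (Ioc ε R))) := by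
    rw [integrable_prod_iff' hHm]
    refine ⟨(ae_restrict_mem measurableSet_Ioc).mono hslice, ?_⟩
    refine Integrable.of_bound (hHm.norm.prod_swap).integral_prod_right' (B₂.toReal * (eLpNorm h 2 volume).toReal) ?_
    filter_upwards [ae_restrict_mem measurableSet_Ioc] with σ hσ
    rw [Real.norm_of_nonneg (integral_nonneg fun x => norm_nonneg _)]
    exact hnormint σ hσ
  -- Fubini
  have hswap : ∫ x, ⟪∫ σ in Ioc ε R, I σ x, h x⟫ = ∫ σ in Ioc ε R, ∫ x, ⟪I σ x, h x⟫ := by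
    have h1 : ∀ x, ⟪∫ σ in Ioc ε R, I σ x, h x⟫ = ∫ σ in Ioc ε R, ⟪I σ x, h x⟫ := by
      intro x
      have hix : Integrable (fun σ => I σ x) ((volume : Measure ℝ).restrict (Ioc ε R)) :=
        Integrable.of_bound ((continuousOn_gradDiv_heatExtension_time hg.1 hK x).mono
          (fun σ hσ => hε.trans_le hσ.1.le) |>.aestronglyMeasurable measurableSet_Ioc) B
          ((ae_restrict_mem measurableSet_Ioc).mono fun σ hσ => (hB σ hσ.1.le).1 x)
      rw [real_inner_comm, ← integral_inner hix (h x)]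
      exact integral_congr_ae (Eventually.of_forall fun σ => real_inner_comm _ _)
    simp_rw [h1]
    exact integral_integral_swap (f := fun x σ => ⟪I σ x, h x⟫) hHint
  rw [hswap]
  -- the `σ`-pointwise bound, integrated
  obtain ⟨hAg, hAgle⟩ := integral_Ioc_integral_divergence_sq_le (R := R) hg hK hε
  obtain ⟨hAh, hAhle⟩ := integral_Ioc_integral_divergence_sq_le (R := R) hh hK' hε
  calc |∫ σ in Ioc ε R, ∫ x, ⟪I σ x, h x⟫|
      ≤ ∫ σ in Ioc ε R, |∫ x, ⟪I σ x, h x⟫| := abs_integral_le_integral_abs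
    _ ≤ ∫ σ in Ioc ε R, (lam * (∫ x, ‖VectorCalculus.divergence (heatExtension g (σ / 2)) x‖ ^ 2) +
          lam⁻¹ * (∫ x, ‖VectorCalculus.divergence (heatExtension h (σ / 2)) x‖ ^ 2)) / 2 := by
        refine setIntegral_mono_on ?_ (((hAg.const_mul lam).add (hAh.const_mul lam⁻¹)).div_const 2)
          measurableSet_Ioc fun σ hσ => ?_
        · exact hHint.integral_prod_right.abs
        · exact abs_integral_inner_gradDiv_heatExtension_le hg hK hh (hε.trans_le hσ.1.le) hlam
    _ = (lam * (∫ σ in Ioc ε R, ∫ x, ‖VectorCalculus.divergence (heatExtension g (σ / 2)) x‖ ^ 2) +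
          lam⁻¹ * (∫ σ in Ioc ε R, ∫ x, ‖VectorCalculus.divergence (heatExtension h (σ / 2)) x‖ ^ 2)) / 2 := by
        rw [integral_div, integral_add (hAg.const_mul lam) (hAh.const_mul lam⁻¹), integral_const_mul,
          integral_const_mul]
    _ ≤ (lam * (2 * T ^ 2 * (eLpNorm g 2 volume).toReal ^ 2) +
          lam⁻¹ * (2 * T ^ 2 * (eLpNorm h 2 volume).toReal ^ 2)) / 2 := by
        gcongr
    _ = T ^ 2 * (lam * (eLpNorm g 2 volume).toReal ^ 2 + lam⁻¹ * (eLpNorm h 2 volume).toReal ^ 2) := by ring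

/-- **`L²` bound of the truncated corrector** (the substitute for the `L²`-boundedness of the
Leray projector in the splitting argument of Barker–Seregin–Šverák 2016, Lemma 3.4): for bounded
measurable `g ∈ L²` and `0 < ε`, `R` arbitrary,
`‖∫_{(ε,R]} ∇div e^{σΔ}g dσ‖_{L²} ≤ 2(‖tr‖² + 1) ‖g‖_{L²}` — apply the pairing bound with `h` the
truncated corrector itself and `λ = 2(‖tr‖² + 1)`. [cite: BarkerSeregin2016, Lemma 2.1 & Lemma 3.4] -/
theorem eLpNorm_integral_gradDiv_heatExtension_le (hg : MemLp g 2 volume) {K : ℝ} (hK : ∀ z, ‖g z‖ ≤ K)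
    {ε R : ℝ} (hε : 0 < ε) :
    eLpNorm (fun x => ∫ σ in Ioc ε R, gradient (VectorCalculus.divergence (heatExtension g σ)) x) 2 volume ≤
      ENNReal.ofReal (2 * (‖(traceCLM : (E →L[ℝ] E) →L[ℝ] ℝ)‖ ^ 2 + 1)) * eLpNorm g 2 volume := by
  set T : ℝ := ‖(traceCLM : (E →L[ℝ] E) →L[ℝ] ℝ)‖ with hT
  set F : E → E := fun x => ∫ σ in Ioc ε R, gradient (VectorCalculus.divergence (heatExtension g σ)) x with hF
  obtain ⟨hFmem, B', hB'⟩ := memLp_integral_gradDiv_heatExtension (R := R) hg hK hε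
  set X : ℝ := (eLpNorm F 2 volume).toReal with hX
  set G : ℝ := (eLpNorm g 2 volume).toReal with hG
  have hX0 : 0 ≤ X := ENNReal.toReal_nonneg
  have hG0 : 0 ≤ G := ENNReal.toReal_nonneg
  have hlam : 0 < 2 * (T ^ 2 + 1) := by positivity
  -- `∫⟪F, F⟫ = X²`
  have hFF : ∫ x, ⟪F x, F x⟫ = X ^ 2 := by
    have h1 : ∫ x, ⟪F x, F x⟫ = ∫ x, ‖F x‖ ^ (2 : ℝ) :=
      integral_congr_ae (Eventually.of_forall fun x => by
        simp only [Real.rpow_two]; exact real_inner_self_eq_norm_sq (F x))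
    rw [h1, hX, hFmem.eLpNorm_eq_integral_rpow_norm (by norm_num) (by norm_num),
      ENNReal.toReal_ofReal (by positivity), ← Real.rpow_natCast _ 2,
      ← Real.rpow_mul (integral_nonneg fun x => by positivity)]
    norm_num
    simp only [hF]
  have hpair := abs_integral_inner_integral_gradDiv_le (R := R) hg hK hFmem hB' hε hlam
  rw [hFF, abs_of_nonneg (sq_nonneg X)] at hpair
  -- `X² ≤ T²(λ G² + λ⁻¹ X²)` with `λ = 2(T²+1)` gives `X ≤ 2(T²+1) G`
  have hkey : X ≤ 2 * (T ^ 2 + 1) * G := by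
    have h1 : T ^ 2 * (2 * (T ^ 2 + 1))⁻¹ ≤ 1 / 2 := by
      rw [← div_eq_mul_inv, div_le_iff₀ hlam]; nlinarith [sq_nonneg T]
    have h2 : X ^ 2 ≤ T ^ 2 * (2 * (T ^ 2 + 1)) * G ^ 2 + X ^ 2 / 2 := by
      have h3 : T ^ 2 * ((2 * (T ^ 2 + 1))⁻¹ * X ^ 2) ≤ X ^ 2 / 2 := by
        have := mul_le_mul_of_nonneg_right h1 (sq_nonneg X)
        linarith [this]
      nlinarith [hpair, h3]
    have h4 : X ^ 2 ≤ (2 * (T ^ 2 + 1) * G) ^ 2 := by nlinarith [sq_nonneg T, sq_nonneg G, sq_nonneg (T * G)]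
    exact (pow_le_pow_iff_left₀ hX0 (by positivity) two_ne_zero).1 h4
  have e1 : eLpNorm F 2 volume = ENNReal.ofReal X := (ENNReal.ofReal_toReal hFmem.eLpNorm_ne_top).symm
  have e2 : eLpNorm g 2 volume = ENNReal.ofReal G := (ENNReal.ofReal_toReal hg.eLpNorm_ne_top).symm
  rw [e1, e2, ← ENNReal.ofReal_mul hlam.le]
  exact ENNReal.ofReal_le_ofReal hkey

end L2Bound

end Literature.Analysis.FluidPDE

end
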